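/-
HONEST FRAMING: certified error envelopes and provably optimal rounding/accumulation schemes for
low-precision formats under stated cost models; every table by two implementations; no hardware
or vendor claims.
-/
import Summits.Ventures.CertifiedArithmetic.LowPrec.OptDemotionLines
import Summits.Ventures.CertifiedArithmetic.LowPrec.OptDemotionNodeWrap

/-!
# The demotion law (Theorem T8), part 5f: CONJECTURE D FOR EVERY TREE with `M_t(u_q) ≤ 2`

OPTIMA.md §B T8(b)(iii) ("Conjecture D") states that the exact worst case of "evaluate the whole
summation tree in the WIDE format `F_q`, round the root ONCE to the NARROW format `F_p`" is opt's
coupled tree polynomial `Q_t` for EVERY tree.  Part 4 (`OptDemotionTreeWitness`) proved `D_t ≥ Q_t`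
for every tree; parts 1 and 3 proved `D_t ≤ Q_t` for chains and for the balanced four-leaf tree.

THIS FILE proves the upper bound for every tree whose wide tree polynomial satisfies `M_t(u_q) ≤ 2`
(i.e. whose worst-case relative error of the wide accumulation alone, `1 - 1/M_t`, is below 50 % —
every tree of height `h` with `(1+u_q)^h ≤ 2`, e.g. height `≤ 170` in bfloat16-wide and `≤ 11·10^6`
in binary32-wide arithmetic, every chain of `≤ 2^q + 1` terms):

* `deficit_line_bound` — THE LINE INVARIANT: if a subtree computes `v > 0` with `σ = ufp(v)`, its
  exact sum is at most `v + σ(α - λ) + λ v` for some good line `(α, λ)` of `goodLines u_q t`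
  (induction over the tree; the node step is `node_covers` of part 5e);
* `exact_le_treeQf_mul_fl` — **`s ≤ Q_t · fl_p(ŝ)`** for all `p, q ≥ 1`, every nearest rounding
  `fl_q` into `F(q, emin)` and `fl_p` into `F(p, emin)` (any tie rules, gradual underflow), every
  tree with `M_t(u_q) ≤ 2` and all nonnegative data in `F(q, emin)` — from the line invariant at the
  root, `1 + u_p + α + λ u_p ≤ Q_t(u_p)` (`line_le_treeQf`) and one demotion step;
* `demotion_tree_relative` — the relative form `s - fl_p(ŝ) ≤ (1 - 1/Q_t)·s`;
* `R4_DemotionLawEveryTree` (+ `_holds`) — statement-style record.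

Together with `demotion_tree_witness` (attained for every tree under the ties-to-even hypotheses,
`q ≥ p + 2`): `D_t = Q_t` exactly for every tree with `M_t ≤ 2` — Conjecture D on that class.  The
hypothesis `M_t ≤ 2` enters only through the node step (children with `M ≤ 2`); whether it can be
dropped is open (the exploration LP finds no obstruction up to `M ≈ 3/2` and abstract ones beyond).
-/

namespace Summit.Ventures.CertifiedArithmetic.LowPrec.Opt

open Literature.ComputerArithmetic.JeannerodRump2018
open Literature.ComputerArithmetic.JeannerodRump2018.SumTree
open Demotion

section Main

variable {q : ℕ} {emin : ℤ} {fl : ℚ → ℚ}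

/-- Children have smaller tree polynomials. -/
theorem treeM_children_le {u : ℚ} (hu0 : 0 ≤ u) (a b : SumTree) :
    treeM u a ≤ treeM u (.node a b) ∧ treeM u b ≤ treeM u (.node a b) := by
  have ha := one_le_treeM hu0 a
  have hb := one_le_treeM hu0 b
  rw [treeM_node]
  have hmin : 0 ≤ u * min (treeM u a) (treeM u b) := mul_nonneg hu0 (le_min (by linarith) (by linarith))
  exact ⟨by linarith [le_max_left (treeM u a) (treeM u b)],
    by linarith [le_max_right (treeM u a) (treeM u b)]⟩

/-- The computed value of a tree of nonnegative floats is a nonnegative float. -/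
theorem eval_isFloat_nonneg (hfl : IsRoundNearest q emin fl) :
    ∀ t : SumTree, (∀ x ∈ leaves t, IsFloat q emin x ∧ 0 ≤ x) →
      IsFloat q emin (eval fl t) ∧ 0 ≤ eval fl t
  | .leaf x, h => by simpa [eval, leaves] using h x (by simp [leaves])
  | .node a b, h => by
      have ha := eval_isFloat_nonneg hfl a (fun x hx => h x (by simp [leaves, hx]))
      have hb := eval_isFloat_nonneg hfl b (fun x hx => h x (by simp [leaves, hx]))
      refine ⟨(hfl _).1, ?_⟩
      exact ha.2.trans (le_fl_of_isFloat_le hfl ha.1 (le_add_of_nonneg_right hb.2))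

/-- THE LINE INVARIANT.  For every tree `t` with `M_t(u_q) ≤ 2` and nonnegative data in `F(q, emin)`:
if the computed value `v` vanishes so does the exact sum, and if `v > 0` then
`exact t - v ≤ ufp(v)·(α - λ) + λ·v` for some good line `(α, λ)` of `t`. -/
theorem deficit_line_bound (hq : 1 ≤ q) (hfl : IsRoundNearest q emin fl) :
    ∀ t : SumTree, (∀ x ∈ leaves t, IsFloat q emin x ∧ 0 ≤ x) → treeM (unitRoundoff q) t ≤ 2 →
      (eval fl t = 0 → exact t ≤ 0) ∧
      (0 < eval fl t → ∃ l ∈ goodLines (unitRoundoff q) t,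
        exact t - eval fl t ≤ (2 : ℚ) ^ (Int.log 2 (eval fl t)) * (l.1 - l.2) + l.2 * eval fl t)
  | .leaf x, h, _ => by
      refine ⟨fun h0 => by simpa [eval, exact] using h0.le, fun _ => ⟨(0, 0), by simp, ?_⟩⟩
      simp [eval, exact]
  | .node a b, h, hM => by
      have hu0 := unitRoundoff_nonneg q
      have hu1 := unitRoundoff_le_one q
      have hla : ∀ x ∈ leaves a, IsFloat q emin x ∧ 0 ≤ x := fun x hx => h x (by simp [leaves, hx])
      have hlb : ∀ x ∈ leaves b, IsFloat q emin x ∧ 0 ≤ x := fun x hx => h x (by simp [leaves, hx])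
      have hMab := treeM_children_le hu0 a b
      obtain ⟨iha0, iha⟩ := deficit_line_bound hq hfl a hla (hMab.1.trans hM)
      obtain ⟨ihb0, ihb⟩ := deficit_line_bound hq hfl b hlb (hMab.2.trans hM)
      obtain ⟨haF, ha0⟩ := eval_isFloat_nonneg hfl a hla
      obtain ⟨hbF, hb0⟩ := eval_isFloat_nonneg hfl b hlb
      have hva_le : eval fl a ≤ eval fl (.node a b) :=
        le_fl_of_isFloat_le hfl haF (le_add_of_nonneg_right hb0)
      have hvb_le : eval fl b ≤ eval fl (.node a b) := by
        simp only [eval]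
        exact le_fl_of_isFloat_le hfl hbF (le_add_of_nonneg_left ha0)
      refine ⟨fun h0 => ?_, fun hpos => ?_⟩
      · -- zero: both children vanish
        have ha' : eval fl a = 0 := le_antisymm (h0 ▸ hva_le) ha0
        have hb' : eval fl b = 0 := le_antisymm (h0 ▸ hvb_le) hb0
        simp only [exact]; linarith [iha0 ha', ihb0 hb']
      · -- positive: the node step
        set v := eval fl (.node a b) with hv
        have hvdef : v = fl (eval fl a + eval fl b) := rfl
        set K := Int.log 2 v with hK
        have hvlo : ((2 : ℕ) : ℚ) ^ K ≤ v := Int.zpow_log_le_self (by norm_num) hpos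
        have hvhi : v < ((2 : ℕ) : ℚ) ^ (K + 1) := Int.lt_zpow_succ_log_self (by norm_num) v
        push_cast at hvlo hvhi
        -- children's active lines (the μ-line when the child computes 0)
        have pick : ∀ (c : SumTree), (0 < eval fl c → ∃ l ∈ goodLines (unitRoundoff q) c,
              exact c - eval fl c ≤ (2 : ℚ) ^ (Int.log 2 (eval fl c)) * (l.1 - l.2) + l.2 * eval fl c) →
            ∃ l ∈ goodLines (unitRoundoff q) c, (0 < eval fl c →
              exact c - eval fl c ≤ (2 : ℚ) ^ (Int.log 2 (eval fl c)) * (l.1 - l.2) + l.2 * eval fl c) := by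
          intro c ih
          by_cases hc : 0 < eval fl c
          · obtain ⟨l, hl, hb⟩ := ih hc; exact ⟨l, hl, fun _ => hb⟩
          · exact ⟨_, mu_mem_goodLines hu0 hu1 c, fun h' => absurd h' hc⟩
        obtain ⟨la, hla_mem, hda⟩ := pick a iha
        obtain ⟨lb, hlb_mem, hdb⟩ := pick b ihb
        obtain ⟨hLa, hAaLa, hMaAa⟩ := goodLines_bounds hu0 hu1 a la hla_mem
        obtain ⟨hLb, hAbLb, hMbAb⟩ := goodLines_bounds hu0 hu1 b lb hlb_mem
        have hMa1 : treeM (unitRoundoff q) a - 1 ≤ 1 := by linarith [hMab.1]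
        have hMb1 : treeM (unitRoundoff q) b - 1 ≤ 1 := by linarith [hMab.2]
        have hcov := node_covers hq hfl (da := exact a - eval fl a) (db := exact b - eval fl b)
          haF hbF ha0 hb0 hLa hAaLa hMaAa hMa1 hLb hAbLb hMbAb hMb1
          (fun h0 => by linarith [iha0 h0]) (fun h0 => by have := hda h0; linarith)
          (fun h0 => by linarith [ihb0 h0]) (fun h0 => by have := hdb h0; linarith)
          (by rw [← hvdef]; exact hvlo) (by rw [← hvdef]; exact hvhi)
        rw [← hvdef] at hcov
        have hex : exact (.node a b) - v
            = (exact a - eval fl a) + (exact b - eval fl b) + (eval fl a + eval fl b - v) := by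
          simp only [exact]; ring
        rw [hex]
        -- read off the covering line
        refine hcov.elim (fun hT => ?_) (fun hT => ?_) (fun hT => ?_) (fun hT => ?_)
          (fun hg hT => ?_) (fun hg hT => ?_) (fun hg hT => ?_) (fun hg hT => ?_)
        · exact ⟨_, mem_goodLines_F1 (b := b) hla_mem, by dsimp only; linarith⟩
        · exact ⟨_, mem_goodLines_F1 (b := b) (mu_mem_goodLines hu0 hu1 a), by dsimp only; linarith⟩
        · exact ⟨_, mem_goodLines_F2 (a := a) hlb_mem, by dsimp only; linarith⟩
        · exact ⟨_, mem_goodLines_F2 (a := a) (mu_mem_goodLines hu0 hu1 b), by dsimp only; linarith⟩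
        · exact ⟨_, mem_goodLines_F3 hlb_mem hg, by dsimp only; linarith⟩
        · exact ⟨_, mem_goodLines_F3 (mu_mem_goodLines hu0 hu1 b) (by simpa using hg),
            by dsimp only; linarith⟩
        · exact ⟨_, mem_goodLines_F4 hla_mem hg, by dsimp only; linarith⟩
        · exact ⟨_, mem_goodLines_F4 (mu_mem_goodLines hu0 hu1 a) (by simpa using hg),
            by dsimp only; linarith⟩

/-- **CONJECTURE D, UPPER BOUND, FOR EVERY TREE WITH `M_t(u_q) ≤ 2`.**  Accumulate a summation tree
of nonnegative `F(q, emin)` data in the wide format with ANY nearest rounding `fl_q`, round the root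
ONCE into `F(p, emin)` with ANY nearest rounding `fl_p` (`p, q ≥ 1`, any tie rules, gradual underflow):
the exact sum satisfies `s ≤ Q_t · fl_p(ŝ)` with opt's coupled tree polynomial
`Q_t = treeQf u_q t u_p`. -/
theorem exact_le_treeQf_mul_fl {p : ℕ} (hp : 1 ≤ p) (hq : 1 ≤ q) {flp : ℚ → ℚ}
    (hfl : IsRoundNearest q emin fl) (hflp : IsRoundNearest p emin flp) (t : SumTree)
    (ht : ∀ x ∈ leaves t, IsFloat q emin x ∧ 0 ≤ x) (hM : treeM (unitRoundoff q) t ≤ 2) :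
    exact t ≤ treeQf (unitRoundoff q) t (unitRoundoff p) * flp (eval fl t) := by
  set u := unitRoundoff q with hu
  set P := unitRoundoff p with hP
  have hu0 : 0 ≤ u := unitRoundoff_nonneg q
  have hu1 : u ≤ 1 := unitRoundoff_le_one q
  have hupos : 0 < u := by rw [hu]; unfold unitRoundoff; positivity
  have hP0 : 0 < P := by rw [hP]; unfold unitRoundoff; positivity
  obtain ⟨hzero, hposcase⟩ := deficit_line_bound hq hfl t ht hM
  obtain ⟨hvF, hv0⟩ := eval_isFloat_nonneg hfl t ht
  set v := eval fl t with hv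
  -- Q ≥ 1 + P (the μ-line)
  have hQ1 : 1 + P ≤ treeQf u t P := by
    have := line_le_treeQf hupos t _ (mu_mem_goodLines hu0 hu1 t) P hP0
    have hM1 := one_le_treeM hu0 t
    dsimp only at this; nlinarith
  rcases eq_or_lt_of_le hv0 with h0 | hpos
  · -- v = 0: everything vanished
    have h0' : v = 0 := h0.symm
    rw [h0', fl_eq_self hflp (isFloat_zero p emin), mul_zero]
    exact hzero h0'
  · obtain ⟨l, hl, hdef⟩ := hposcase hpos
    obtain ⟨hL0, hLA, -⟩ := goodLines_bounds hu0 hu1 t l hl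
    have hQ : 1 + P + l.1 + l.2 * P ≤ treeQf u t P := line_le_treeQf hupos t l hl P hP0
    set K := Int.log 2 v with hK
    have hvlo : ((2 : ℕ) : ℚ) ^ K ≤ v := Int.zpow_log_le_self (by norm_num) hpos
    have hvhi : v < ((2 : ℕ) : ℚ) ^ (K + 1) := Int.lt_zpow_succ_log_self (by norm_num) v
    push_cast at hvlo hvhi
    have hσpos : (0 : ℚ) < (2 : ℚ) ^ K := zpow_pos (by norm_num) _
    have hQ0 : 0 ≤ treeQf u t P := by linarith
    -- the line bound in the form  exact ≤ (1 + λ) v + σ (α - λ)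
    have hex : exact t ≤ v + (2 : ℚ) ^ K * (l.1 - l.2) + l.2 * v := by linarith
    by_cases hsmall : v < (2 : ℚ) ^ (emin + p)
    · -- no demotion error
      have hr : flp v = v := fl_eq_self hflp (isFloat_narrow_of_small hvF hv0 hsmall)
      rw [hr]
      have h1 : exact t ≤ (1 + P + l.1 + l.2 * P) * v := by
        have hal : (2 : ℚ) ^ K * (l.1 - l.2) ≤ v * (l.1 - l.2) :=
          mul_le_mul_of_nonneg_right hvlo (by linarith)
        nlinarith [mul_nonneg hP0.le (mul_nonneg hL0 hv0), mul_nonneg hP0.le hv0]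
      exact h1.trans (mul_le_mul_of_nonneg_right hQ hv0)
    · -- demotion in the normal range of F_p
      have hbig : (2 : ℚ) ^ (emin + p) ≤ v := not_lt.mp hsmall
      have hKe : emin + p ≤ K + 1 := by
        by_contra hlt
        have : (2 : ℚ) ^ (K + 1) ≤ (2 : ℚ) ^ (emin + (p : ℤ)) :=
          zpow_le_zpow_right₀ (by norm_num) (by omega)
        linarith
      have herr := abs_sub_fl_le_half_ulp hp hflp hvlo hvhi hKe
      have hr_ge : (2 : ℚ) ^ K ≤ flp v :=
        le_fl_of_isFloat_le hflp (PTree.isFloat_two_zpow hp (by omega)) hvlo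
      have hr_lo : v - P * (2 : ℚ) ^ K ≤ flp v := by
        have := (abs_le.mp herr).2; rw [hP]; linarith
      rcases le_or_gt v ((2 : ℚ) ^ K + P * (2 : ℚ) ^ K) with hA | hB
      · -- v at most the first midpoint: the whole deficit is measured at scale σ ≤ r
        have h1 : exact t ≤ (1 + P + l.1 + l.2 * P) * (2 : ℚ) ^ K := by
          nlinarith [mul_le_mul_of_nonneg_left hA (by linarith : (0 : ℚ) ≤ 1 + l.2)]
        calc exact t ≤ (1 + P + l.1 + l.2 * P) * (2 : ℚ) ^ K := h1
          _ ≤ treeQf u t P * (2 : ℚ) ^ K := mul_le_mul_of_nonneg_right hQ hσpos.le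
          _ ≤ treeQf u t P * flp v := mul_le_mul_of_nonneg_left hr_ge hQ0
      · -- v above the first midpoint: r ≥ v - u_p σ and the slope of the line does the rest
        have hgap : 0 ≤ v - (2 : ℚ) ^ K - P * (2 : ℚ) ^ K := by linarith
        have hcoef : 0 ≤ l.1 - l.2 + P * (1 + l.2) := by nlinarith
        have h1 : exact t ≤ (1 + P + l.1 + l.2 * P) * (v - P * (2 : ℚ) ^ K) := by
          nlinarith [mul_nonneg hgap hcoef]
        have hline0 : 0 ≤ 1 + P + l.1 + l.2 * P := by nlinarith
        calc exact t ≤ (1 + P + l.1 + l.2 * P) * (v - P * (2 : ℚ) ^ K) := h1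
          _ ≤ (1 + P + l.1 + l.2 * P) * flp v := mul_le_mul_of_nonneg_left hr_lo hline0
          _ ≤ treeQf u t P * flp v :=
              mul_le_mul_of_nonneg_right hQ (le_trans hσpos.le hr_ge)

/-- Relative form: the demoted result under-estimates the exact sum by at most the fraction
`1 - 1/Q_t` (every tree with `M_t(u_q) ≤ 2`). -/
theorem demotion_tree_relative {p : ℕ} (hp : 1 ≤ p) (hq : 1 ≤ q) {flp : ℚ → ℚ}
    (hfl : IsRoundNearest q emin fl) (hflp : IsRoundNearest p emin flp) (t : SumTree)
    (ht : ∀ x ∈ leaves t, IsFloat q emin x ∧ 0 ≤ x) (hM : treeM (unitRoundoff q) t ≤ 2) :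
    exact t - flp (eval fl t)
      ≤ (1 - 1 / treeQf (unitRoundoff q) t (unitRoundoff p)) * exact t := by
  have h := exact_le_treeQf_mul_fl hp hq hfl hflp t ht hM
  have hu0 : 0 ≤ unitRoundoff q := unitRoundoff_nonneg q
  have hupos : 0 < unitRoundoff q := by unfold unitRoundoff; positivity
  have hP0 : 0 < unitRoundoff p := by unfold unitRoundoff; positivity
  have hQ : 0 < treeQf (unitRoundoff q) t (unitRoundoff p) := by
    have := line_le_treeQf hupos t _ (mu_mem_goodLines hu0 (unitRoundoff_le_one q) t)
      (unitRoundoff p) hP0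
    have hM1 := one_le_treeM hu0 t
    dsimp only at this; nlinarith
  rw [sub_mul, one_mul, div_mul_eq_mul_div, one_mul, sub_le_sub_iff_left, div_le_iff₀ hQ]
  linarith

end Main

/-! ## Statement-style record (R4, CM-B / demote) -/

/-- R4 (Opt, CM-B demotion, OPTIMA T8(b)(iii) upper bound): for all precisions `p, q ≥ 1`, every
nearest rounding `fl_q` into `F(q, emin)` and `fl_p` into `F(p, emin)`, every summation tree `t` with
`M_t(u_q) ≤ 2` and all nonnegative data in `F(q, emin)`: the tree evaluated in `F_q` and demoted once
to `F_p` satisfies `s ≤ Q_t · fl_p(ŝ)`, `Q_t = treeQf u_q t u_p` opt's coupled tree polynomial. -/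
def R4_DemotionLawEveryTree : Prop :=
  ∀ (p q : ℕ) (emin : ℤ) (flq flp : ℚ → ℚ), 1 ≤ p → 1 ≤ q →
    IsRoundNearest q emin flq → IsRoundNearest p emin flp →
    ∀ t : SumTree, (∀ x ∈ leaves t, IsFloat q emin x ∧ 0 ≤ x) → treeM (unitRoundoff q) t ≤ 2 →
      exact t ≤ treeQf (unitRoundoff q) t (unitRoundoff p) * flp (eval flq t)

/-- Discharge of `R4_DemotionLawEveryTree` by `exact_le_treeQf_mul_fl`. -/
theorem R4_DemotionLawEveryTree_holds : R4_DemotionLawEveryTree :=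
  fun _ _ _ _ _ hp hq hflq hflp t ht hM => exact_le_treeQf_mul_fl hp hq hflq hflp t ht hM

/-- NUMBERS (the hypothesis `M_t ≤ 2` in two wide formats): a chain of 17 terms in FP8-E4M3-wide
arithmetic (`q = 4`: `1 + 16·2^-4 = 2`) and every tree of height `≤ 170` in bfloat16-wide arithmetic
(`q = 8`: `(1 + 2^-8)^170 ≤ 2`, the tree polynomial of a tree of height `h` being at most `(1+u)^h`). -/
theorem treeM_le_two_examples :
    (1 : ℚ) + 16 * (1 / 2 ^ 4) ≤ 2 ∧ ((1 : ℚ) + 1 / 2 ^ 8) ^ 170 ≤ 2 := by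
  constructor <;> norm_num

end Summit.Ventures.CertifiedArithmetic.LowPrec.Opt
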